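import Mathlib
import Literature.RepresentationTheory.CompactGroups.DerivationFlows

/-!
# Exp-germ (class 𝓔) TPP triples: the commuting-pair obstruction, the torsion–isotropy core of
# Lemma A, and the Cor 2.8 ↔ Lie-exponent dictionary arithmetic

Solo-blind seat, door L (Lie-group TPP constructions, Blasiak–Cohn–Grochow–Pratt–Umans,
arXiv:2204.03826 = BCGPU22 and arXiv:2410.14905 = BCGPU24), companion to `paper/LieExponent.md`
§3.21.  Three small kernel anchors of pen-and-paper statements made there:

* **(C_comm)** — for an *exp-germ triple* `(exp W₁, exp W₂, exp W₃)` (`Wᵢ` linear subspaces of a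
  real Banach algebra; all of BCGPU24's triples `D^{∓1} e^{εS} D^{±1} = exp(ε D^{∓1} S D^{±1})` and
  all Lie-subgroup triples have this shape) a commuting pair `w₁ ∈ W₁`, `w₂ ∈ W₂` with
  `w₁ + w₂ ∈ W₃` produces the solution `exp w₁ · exp w₂ · exp (−(w₁+w₂)) = 1` of the triple-product
  equation inside `exp W₁ · exp W₂ · exp W₃` (`soloLie_classE_comm_witness`,
  `soloLie_classE_comm_solution`); with `w₁ ≠ 0` small this violates the triple product property.
* **Lemma A, linear-algebra core** — if a bilinear form is a "torsion" `B(u,x) = β x u − β u x`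
  of a form `β` whose partial maps `β u` lie in a subspace `R` of the dual, then `ker β` is
  `B`-isotropic and has codimension `≤ dim R` (`soloLie_torsion_ker_isotropic`,
  `soloLie_torsion_ker_codim`).  In §3.21(d) `β(u,x) = (D_u μ)(x)` for a moving common annihilator
  `μ` of the three right-trivialised tangent spaces, `R = (V_j + V_k)^⊥|_{V_i}` has dimension
  `≤ mᵢ − 1`, and `B = B_μ(u,x) = μ([u,x])` by the torsion identity.
* **Dictionary arithmetic** — BCGPU24 Cor 2.8 reads `(|X||Y||Z|)^{ω/3} ≤ s^{C(n,2)(ω−2)}·C(s+n²,n²)`;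
  with sizes `s^{aᵢ}` and `s → ∞` this is `ω·A ≤ C(n,2)(ω−2) + n²`, `A` the mean density, whence
  `ω ≤ n/(A − C(n,2))` (`soloLie_cor28_exponent`); at density ½ per real dimension
  (`A = mean dim_ℝ / 2`) this is literally BCGPU22's Lie-exponent value `2n/(mean − n² + n)` of the
  manifold triple in `GL_n(ℂ)` (`soloLie_density_half_identity`), and the Kirillov threshold
  `mean ≤ d/2 − r/6` of the seat's Theorem 5 is exactly "certified exponent ≥ 3"
  (`soloLie_cor28_kirillov_threshold`).

All statements are elementary; they are recorded so that the bookkeeping of §3.21 is kernel-checked.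
[new; bookkeeping on BCGPU24 Cor 2.8 p.15, Rem 1.3 p.6, Thm 3.1 p.25 and BCGPU22 Def 4.1 p.8]
-/

set_option linter.dupNamespace false

namespace Summit.MatrixMultiplication.MatrixMultiplication.Theorems

open NormedSpace

section CommWitness

variable {𝔸 : Type*} [NormedRing 𝔸] [NormedAlgebra ℝ 𝔸] [CompleteSpace 𝔸]

/-- (C_comm): a commuting pair solves the triple-product equation of an exp-germ triple:
`exp w₁ · exp w₂ · exp (−(w₁ + w₂)) = 1`. [new] -/
theorem soloLie_classE_comm_witness {x y : 𝔸} (h : Commute x y) :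
    exp x * exp y * exp (-(x + y)) = 1 := by
  rw [← Literature.RepresentationTheory.CompactGroups.exp_add_of_commute_real h,
    ← Literature.RepresentationTheory.CompactGroups.exp_add_of_commute_real
      ((Commute.refl (x + y)).neg_right),
    add_neg_cancel, exp_zero]

/-- (C_comm) in set form: if `w₁ ∈ W₁`, `w₂ ∈ W₂` commute and `w₁ + w₂ ∈ W₃` then the triple
`(exp w₁, exp w₂, exp (−(w₁+w₂))) ∈ exp W₁ × exp W₂ × exp W₃` multiplies to `1`; so an exp-germ
TPP triple admits no such pair with `w₁ ≠ 0` near `0`. [new] -/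
theorem soloLie_classE_comm_solution (W₁ W₂ W₃ : Submodule ℝ 𝔸) {w₁ w₂ : 𝔸}
    (h₁ : w₁ ∈ W₁) (h₂ : w₂ ∈ W₂) (h₃ : w₁ + w₂ ∈ W₃) (hc : Commute w₁ w₂) :
    ∃ a ∈ exp '' (W₁ : Set 𝔸), ∃ b ∈ exp '' (W₂ : Set 𝔸), ∃ c ∈ exp '' (W₃ : Set 𝔸),
      a * b * c = 1 ∧ a = exp w₁ ∧ b = exp w₂ :=
  ⟨exp w₁, ⟨w₁, h₁, rfl⟩, exp w₂, ⟨w₂, h₂, rfl⟩, exp (-(w₁ + w₂)),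
    ⟨-(w₁ + w₂), W₃.neg_mem h₃, rfl⟩, soloLie_classE_comm_witness hc, rfl, rfl⟩

end CommWitness

section TorsionIsotropy

variable {K V : Type*} [Field K] [AddCommGroup V] [Module K V]

/-- Lemma A, core: the torsion `B(u,x) = β x u − β u x` of any bilinear form `β` vanishes on
`ker β × ker β`, i.e. `ker β` is `B`-isotropic. [new] -/
theorem soloLie_torsion_ker_isotropic (β : V →ₗ[K] V →ₗ[K] K) {u x : V}
    (hu : u ∈ LinearMap.ker β) (hx : x ∈ LinearMap.ker β) :
    β x u - β u x = 0 := by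
  rw [LinearMap.mem_ker] at hu hx
  rw [hu, hx]
  simp

/-- Lemma A, dimension count: if every partial map `β u` lies in a subspace `R` of the dual
(in §3.21(d): the restrictions to `Vᵢ` of `(V_j + V_k)^⊥`, of dimension `≤ mᵢ − 1`), then the
isotropic subspace `ker β` has codimension `≤ dim R`. [new] -/
theorem soloLie_torsion_ker_codim [FiniteDimensional K V] (β : V →ₗ[K] V →ₗ[K] K)
    (R : Submodule K (V →ₗ[K] K)) (hR : LinearMap.range β ≤ R) :
    Module.finrank K V ≤ Module.finrank K (LinearMap.ker β) + Module.finrank K R := by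
  have h1 := LinearMap.finrank_range_add_finrank_ker β
  have h2 : Module.finrank K (LinearMap.range β) ≤ Module.finrank K R :=
    Submodule.finrank_mono hR
  omega

end TorsionIsotropy

section Dictionary

/-- BCGPU24 Cor 2.8 in exponent form: sizes `s^{aᵢ}` with mean `A`, separating degree `s → ∞`,
give `ω·A ≤ C(n,2)(ω − 2) + n²`; if `A > C(n,2)` this certifies `ω ≤ n/(A − C(n,2))`
(because `n² − 2·C(n,2) = n`). [new; arithmetic of BCGPU24 Cor 2.8 p.15] -/
theorem soloLie_cor28_exponent (n ω A : ℝ) (hA : n * (n - 1) / 2 < A)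
    (h : ω * A ≤ n * (n - 1) / 2 * (ω - 2) + n ^ 2) :
    ω ≤ n / (A - n * (n - 1) / 2) := by
  rw [le_div_iff₀ (by linarith)]
  have e : ω * (A - n * (n - 1) / 2) = ω * A - (n * (n - 1) / 2 * (ω - 2) + n ^ 2) + n := by
    ring
  rw [e]
  linarith

/-- Density ½ per real dimension (`A = m/2`, `m` the mean real dimension of the manifold triple)
turns the Cor 2.8 exponent `n/(A − C(n,2))` into BCGPU22's Lie-exponent value
`r/(m − (d − r)/2)` of the triple in `GL_n(ℂ)`, `d = 2n²`, `r = 2n`. [new; bookkeeping] -/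
theorem soloLie_density_half_identity (n m : ℝ) :
    n / (m / 2 - n * (n - 1) / 2) = 2 * n / (m - (2 * n ^ 2 - 2 * n) / 2) := by
  have e1 : m / 2 - n * (n - 1) / 2 = (m - n ^ 2 + n) / 2 := by ring
  have e2 : m - (2 * n ^ 2 - 2 * n) / 2 = m - n ^ 2 + n := by ring
  rw [e1, e2, div_div_eq_mul_div]
  ring

/-- The Kirillov threshold is exactly "certified exponent ≥ 3": if the mean dimension `m` of a TPP
triple satisfies `m ≤ d/2 − r/6` (the seat's Theorem 5 for Lie-subgroup triples: `Σ ≤ (3d − r)/2`,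
`r = ind 𝔤`) and the Lie-exponent denominator is positive, then the Lie-exponent value
`r/(m − (d − r)/2)` is at least `3`. [new; bookkeeping] -/
theorem soloLie_cor28_kirillov_threshold (d r m : ℝ)
    (hpos : 0 < m - (d - r) / 2) (hK : m ≤ d / 2 - r / 6) :
    3 ≤ r / (m - (d - r) / 2) := by
  rw [le_div_iff₀ hpos]
  linarith

end Dictionary

end Summit.MatrixMultiplication.MatrixMultiplication.Theorems
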